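import Mathlib

/-!
# `NewtonTauWeak` (stmt-ValiantsHypothesis-5904), line `binomial-normal-form`: objects of the CORNER MODEL

Route-posited objects (D-0016 `…Defs` file) for the local analysis of the open stub
`stub_binomialNewtonTauCommon` (KPTT arXiv:1308.2286 Conj. 1 at `t = 2`) at a common corner of several
binomial products, as set up in `Cruxes/NewtonTauWeak/Lines/binomial-normal-form-ltc.md` (lead c2, §2–§5):
after the flip identity every product is `X^{p_l} Π_e P_{l,e}(X^{E_e})` with directions `E_e ∈ ℤ²` of
positive weight and univariate factors alive at the corner; dividing by the lowest product leaves a corner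
combination `κ₁ Π_e U_e(X^{E_e}) + κ₂ Π_e W_e(X^{E_e}) - 1`.  The coefficient of a lattice point `z` is a
FIBRE SUM of the rank-two tensor `κ₁ ⊗U + κ₂ ⊗W` over the words `n ∈ {0..D}^s` with `Σ_e n_e E_e = z`
(coinciding subset sums allowed).  Objects: the real weight `wt`, the push-forward `push`, on-ray points
`OnRay`, the separated coefficient `sepCoeff`, the word box `box`, the fibre sum `fibreSum`, orders of
univariate factors at the corner (`IsOrder`, `Active`).  Everything is a definition [folklore]; the first
user is `Theorems/NewtonUnitEquationsNewtonTauWeakCornerRigidity.lean` (the `K = 3` corner rigidity lemma).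
-/

-- the namespace mandated for this Theorems file repeats the component `ValiantsHypothesis`
set_option linter.dupNamespace false

noncomputable section

open scoped BigOperators Polynomial

namespace Summit.ValiantsHypothesis.ValiantsHypothesis.Theorems.NewtonTauWeakCorner

/-! ## Definitions (the local corner model of three separated products, line `binomial-normal-form`) -/

/-- The real weight `⟨w, z⟩ = w₀ z₀ + w₁ z₁` of a lattice point `z ∈ ℤ²`. [folklore] -/
def wt (w : Fin 2 → ℝ) (z : Fin 2 → ℤ) : ℝ := w 0 * (z 0 : ℝ) + w 1 * (z 1 : ℝ)

/-- The push-forward of a word of multiplicities along a list of directions: `n ↦ Σ_e n_e · E_e ∈ ℤ²`.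
[folklore] -/
def push {s : ℕ} (E : Fin s → Fin 2 → ℤ) (n : Fin s → ℕ) : Fin 2 → ℤ := ∑ e, (n e : ℤ) • E e

/-- On-ray lattice points: positive multiples of a direction of the list. [folklore] -/
def OnRay {s : ℕ} (E : Fin s → Fin 2 → ℤ) (z : Fin 2 → ℤ) : Prop := ∃ e : Fin s, ∃ k : ℕ, 1 ≤ k ∧ z = (k : ℤ) • E e

/-- The separated (rank-one) coefficient of a word: `Π_e [s^{n_e}] U_e`. [folklore] -/
def sepCoeff {s : ℕ} (U : Fin s → ℂ[X]) (n : Fin s → ℕ) : ℂ := ∏ e, (U e).coeff (n e)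

/-- The word box `{0,…,D}^s`. [folklore] -/
def box (s D : ℕ) : Finset (Fin s → ℕ) := Fintype.piFinset fun _ => Finset.range (D + 1)

/-- The fibre sum of the corner combination `κ₁ Π_e U_e(X^{E_e}) + κ₂ Π_e W_e(X^{E_e})` at a lattice point
`z`: the coefficient of `X^z` (the constant `-1` of the corner model lives at `z = 0` only and is omitted).
[folklore] -/
def fibreSum {s : ℕ} (E : Fin s → Fin 2 → ℤ) (D : ℕ) (κ₁ κ₂ : ℂ) (U W : Fin s → ℂ[X]) (z : Fin 2 → ℤ) : ℂ :=
  ∑ n ∈ (box s D).filter (fun n => push E n = z), (κ₁ * sepCoeff U n + κ₂ * sepCoeff W n)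

/-- `k` is the ORDER of the univariate factor `P` at the corner: the least positive exponent with a nonzero
coefficient (`P - P(0)` has `s`-adic order `k`). [folklore] -/
def IsOrder (P : ℂ[X]) (k : ℕ) : Prop := 1 ≤ k ∧ P.coeff k ≠ 0 ∧ ∀ j, 1 ≤ j → j < k → P.coeff j = 0

/-- Activity of a univariate factor at the corner: some positive-order coefficient is nonzero. [folklore] -/
def Active (P : ℂ[X]) : Prop := ∃ k, 1 ≤ k ∧ P.coeff k ≠ 0

/-! ## Routine API: additivity of the weight, weight of a pushed word -/

/-- Additivity of the weight. [folklore] -/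
theorem wt_add (w : Fin 2 → ℝ) (z z' : Fin 2 → ℤ) : wt w (z + z') = wt w z + wt w z' := by
  simp only [wt, Pi.add_apply, Int.cast_add]; ring

/-- Weight of an integer multiple. [folklore] -/
theorem wt_zsmul (w : Fin 2 → ℝ) (k : ℤ) (z : Fin 2 → ℤ) : wt w (k • z) = (k : ℝ) * wt w z := by
  simp only [wt, Pi.smul_apply, smul_eq_mul, Int.cast_mul]; ring

/-- Weight of the origin. [folklore] -/
theorem wt_zero (w : Fin 2 → ℝ) : wt w 0 = 0 := by simp [wt]

/-- Weight of a finite sum. [folklore] -/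
theorem wt_sum (w : Fin 2 → ℝ) {ι : Type*} (t : Finset ι) (f : ι → Fin 2 → ℤ) :
    wt w (∑ i ∈ t, f i) = ∑ i ∈ t, wt w (f i) := by
  classical
  induction t using Finset.induction_on with
  | empty => simp [wt_zero]
  | insert a t ha ih => rw [Finset.sum_insert ha, Finset.sum_insert ha, wt_add, ih]

/-- The weight of a pushed word is the multiplicity-weighted sum of the direction weights. [folklore] -/
theorem wt_push {s : ℕ} (E : Fin s → Fin 2 → ℤ) (w : Fin 2 → ℝ) (n : Fin s → ℕ) :
    wt w (push E n) = ∑ e, (n e : ℝ) * wt w (E e) := by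
  unfold push
  rw [wt_sum]
  refine Finset.sum_congr rfl fun e _ => ?_
  rw [wt_zsmul]; simp

end Summit.ValiantsHypothesis.ValiantsHypothesis.Theorems.NewtonTauWeakCorner

end
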